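import Literature.Probability.RandomPlanarGeometry.SAWBridgeDivergence
import Literature.Probability.RandomPlanarGeometry.SAWPolygonsFromBridges
import Mathlib.Analysis.PSeries

/-!
# Subsequential bridge and polygon abundance on `ℤ^d` / `ℤ²`

Topic `Literature/Probability/RandomPlanarGeometry` (continues `SAWBridgeDivergence.lean`: Kesten's
divergence `B_{z_c} = Σ_N b_N μ^{-N} = +∞`, Madras–Slade Corollary 3.1.8, PROVED there as
`Zd.MadrasSlade1993_cor318_holds`; and `SAWPolygonsFromBridges.lean`: the planar two-bridge polygon
construction of Madras–Slade Theorem 3.2.4, `Zd.sq_bridgeCount_le_card_targetWalks`).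

Source of the statements: H. Duminil-Copin, S. Ganguly, A. Hammond, I. Manolescu, *Bounding the number
of self-avoiding walks: Hammersley–Welsh with polygon insertion*, Ann. Probab. 48 (2020),
arXiv:1809.00760. In the proof of Proposition 3.1 (§3.1): "a variation of the Hammersley-Welsh argument
… establishes that the partition function for bridges diverges at its radius of convergence `μ^{-1}`:
`Σ_{m≥1} μ^{-m}|SAB_m| = ∞`. Let `ε > 0`. There are thus infinitely many values of `m ∈ ℕ` such that
`|SAB_m| ≥ m^{-1-ε} μ^m`." And §1.2: the improved Hammersley–Welsh bound "requires a power-law lower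
bound on the correction to exponential growth for self-avoiding polygons of a given length … This bound
is available only subsequentially for `ℤ²`" (polygon abundance, obtained there from bridge abundance by
Lemma 1.6 = Madras–Slade Theorem 3.2.4).

## Contents (namespace `Literature.Probability.RandomPlanarGeometry.SAW.Zd`, all PROVED)

* `frequently_rpow_mul_pow_le_bridgeCount` — **subsequential bridge abundance** on `ℤ^d`, `d ≥ 1`:
  for every `s > 1`, `m^{-s} μ^m ≤ b_m` for infinitely many `m` (from `MadrasSlade1993_cor318_holds`
  and the convergence of `Σ m^{-s}`).
* `sq_bridgeCount_le_poly_mul_countAt_eDown` — Theorem 3.2.4 on `ℤ²` summed over the horizontal-step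
  classes of `SAWPolygonsFromBridges.lean`: `b_M² ≤ (2M+1)⁴ (M+1)⁴ · c_{2M+1}(0,e)`, `e = (0,-1)`,
  `M ≥ 1` (`c_{2M+1}(0,e)` = the `(2M+1)`-step self-avoiding walks from `0` to the neighbour `e`, i.e.
  the `(2M+2)`-step self-avoiding polygons through the bond `{e,0}`, rooted and oriented).
* `countAt_eDown_ge_of_bridgeCount_ge` — the pointwise transfer: `c · M^{-C} μ^M ≤ b_M` (`M ≥ 1`,
  `c ≥ 0`) gives `(c²/1296) · M^{-(2C+8)} μ^{2M} ≤ c_{2M+1}(0,e)` (`(2M+1)⁴(M+1)⁴ ≤ 1296 M⁸`, a private arithmetic helper).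
* `frequently_rpow_mul_pow_le_countAt_eDown` — **subsequential polygon abundance** on `ℤ²`: for every
  `s > 1`, `M^{-(2s+8)} μ^{2M} / 1296 ≤ c_{2M+1}(0,e)` for infinitely many `M`.

## Design choices / not here

* Polygons are represented, as in `SAWPolygonsFromBridges.lean`, by closing walks `0 → e` (rooted,
  oriented); the unrooted polygon count differs by the factor `2M+2` (root) — polynomial, immaterial here.
* The exponents are the crude ones of the tree's Theorem 3.2.4 (`(2M+1)⁴(M+1)⁴`), not the printed
  `4(2n+1)n(n+1)³` of DGHM Lemma 1.6; only polynomial order matters for "abundance".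
* NOT here: abundance for ALL `m` (open on `ℤ^d`, `d = 2,3,4`), and the wide-polygon abundance of DGHM
  Proposition 3.1 (needs their Lemma 3.3 join and the width/height vocabulary).
-/

noncomputable section

open Filter Literature.Probability.LatticeModels Literature.Probability.Percolation
open scoped BigOperators

namespace Literature.Probability.RandomPlanarGeometry.SAW.Zd

/-! ### Subsequential bridge abundance on `ℤ^d` -/

section AnyD

variable (d : ℕ) [NeZero d]

/-- **Subsequential bridge abundance** (DGHM 2020, proof of Proposition 3.1: "There are thus
infinitely many values of `m ∈ ℕ` such that `|SAB_m| ≥ m^{-1-ε}μ^m`"), here for any exponent `s > 1`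
in place of `1 + ε`: `m^{-s} μ^m ≤ b_m` for infinitely many `m`, on `ℤ^d`, `d ≥ 1`. From Kesten's
divergence `Σ_m b_m μ^{-m} = ∞` (`MadrasSlade1993_cor318_holds`) and `Σ_m m^{-s} < ∞`.
[cite: DuminilCopinGangulyHammondManolescu2020, §3.1, proof of Proposition 3.1] -/
theorem frequently_rpow_mul_pow_le_bridgeCount {s : ℝ} (hs : 1 < s) :
    ∃ᶠ m : ℕ in atTop, (m : ℝ) ^ (-s) * connectiveConstant d ^ m ≤ (bridgeCount d m : ℝ) := by
  by_contra h
  rw [not_frequently] at h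
  have hμ := connectiveConstant_pos d
  -- eventually `b_m μ^{-m} < m^{-s}`, a summable majorant
  have hsum : Summable fun m : ℕ => (bridgeCount d m : ℝ) / connectiveConstant d ^ m := by
    refine Summable.of_norm_bounded_eventually_nat (Real.summable_nat_rpow.2 (by linarith : -s < -1)) ?_
    filter_upwards [h] with m hm
    have hμm : 0 < connectiveConstant d ^ m := pow_pos hμ m
    rw [Real.norm_of_nonneg (by positivity), div_le_iff₀ hμm]
    exact (not_le.1 hm).le
  exact MadrasSlade1993_cor318_holds d hsum

end AnyD

/-! ### From bridges to rooted polygons on `ℤ²` (Madras–Slade Theorem 3.2.4, summed) -/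

/-- Each horizontal-step class of the target walks of `SAWPolygonsFromBridges.lean` is a set of
`(2M+1)`-step self-avoiding walks from `0` to `e = (0,-1)`: `#targetWalks M m ≤ c_{2M+1}(0,e)`.
[cite: MadrasSlade1993, §3.2 (proof of Theorem 3.2.4)] -/
theorem card_targetWalks_le_countAt_eDown (M m : ℕ) :
    (targetWalks M m).card ≤ countAt 2 (2 * M + 1) eDown := by
  classical
  rw [← card_sawFun]
  exact Finset.card_filter_le _ _

/-- **Madras–Slade Theorem 3.2.4 on `ℤ²`, closing-walk form**: `b_M² ≤ (2M+1)⁴ (M+1)⁴ · c_{2M+1}(0,e)`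
for `M ≥ 1` (the tree's `sq_bridgeCount_le_card_targetWalks` with its horizontal-step class bounded by
the full count). [cite: MadrasSlade1993, Theorem 3.2.4] -/
theorem sq_bridgeCount_le_poly_mul_countAt_eDown {M : ℕ} (hM : 1 ≤ M) :
    bridgeCount 2 M ^ 2 ≤ (2 * M + 1) ^ 4 * (M + 1) ^ 4 * countAt 2 (2 * M + 1) eDown := by
  obtain ⟨m, -, hle⟩ := sq_bridgeCount_le_card_targetWalks hM
  exact hle.trans (Nat.mul_le_mul_left _ (card_targetWalks_le_countAt_eDown M m))

/-- The crude polynomial of Theorem 3.2.4 is at most `1296 M⁸` for `M ≥ 1`. [folklore] -/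
private theorem thm324_poly_le {M : ℕ} (hM : 1 ≤ M) : (2 * M + 1) ^ 4 * (M + 1) ^ 4 ≤ 1296 * M ^ 8 := by
  have h1 : 2 * M + 1 ≤ 3 * M := by omega
  have h2 : M + 1 ≤ 2 * M := by omega
  calc (2 * M + 1) ^ 4 * (M + 1) ^ 4 ≤ (3 * M) ^ 4 * (2 * M) ^ 4 :=
        Nat.mul_le_mul (Nat.pow_le_pow_left h1 4) (Nat.pow_le_pow_left h2 4)
    _ = 1296 * M ^ 8 := by ring

/-- **Pointwise transfer of abundance from bridges to rooted polygons** (DGHM 2020 §1.2 / Lemma 1.6;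
Madras–Slade Theorem 3.2.4): if `c · M^{-C} μ^M ≤ b_M` with `M ≥ 1`, `c ≥ 0`, then
`(c²/1296) · M^{-(2C+8)} μ^{2M} ≤ c_{2M+1}(0,e)`.
[cite: DuminilCopinGangulyHammondManolescu2020, Lemma 1.6] -/
theorem countAt_eDown_ge_of_bridgeCount_ge {M : ℕ} (hM : 1 ≤ M) {c C : ℝ} (hc : 0 ≤ c)
    (hb : c * (M : ℝ) ^ (-C) * connectiveConstant 2 ^ M ≤ (bridgeCount 2 M : ℝ)) :
    c ^ 2 / 1296 * (M : ℝ) ^ (-(2 * C + 8)) * connectiveConstant 2 ^ (2 * M) ≤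
      (countAt 2 (2 * M + 1) eDown : ℝ) := by
  have hMpos : (0 : ℝ) < (M : ℝ) := by exact_mod_cast hM
  -- real-number form of Theorem 3.2.4 with the polynomial bounded by `1296 M⁸`
  have hsqR : (bridgeCount 2 M : ℝ) ^ 2 ≤
      1296 * (M : ℝ) ^ 8 * (countAt 2 (2 * M + 1) eDown : ℝ) := by
    have h1 : ((bridgeCount 2 M ^ 2 : ℕ) : ℝ) ≤
        (((2 * M + 1) ^ 4 * (M + 1) ^ 4 * countAt 2 (2 * M + 1) eDown : ℕ) : ℝ) := by
      exact_mod_cast sq_bridgeCount_le_poly_mul_countAt_eDown hM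
    have h2 : (((2 * M + 1) ^ 4 * (M + 1) ^ 4 : ℕ) : ℝ) ≤ ((1296 * M ^ 8 : ℕ) : ℝ) := by
      exact_mod_cast thm324_poly_le hM
    push_cast at h1 h2 ⊢
    exact h1.trans (mul_le_mul_of_nonneg_right h2 (Nat.cast_nonneg _))
  -- square the hypothesis
  have hlow : 0 ≤ c * (M : ℝ) ^ (-C) * connectiveConstant 2 ^ M :=
    mul_nonneg (mul_nonneg hc (Real.rpow_nonneg hMpos.le _))
      (pow_nonneg (connectiveConstant_pos 2).le _)
  have hsq2 : (c * (M : ℝ) ^ (-C) * connectiveConstant 2 ^ M) ^ 2 ≤ (bridgeCount 2 M : ℝ) ^ 2 :=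
    pow_le_pow_left₀ hlow hb 2
  have hMC2 : ((M : ℝ) ^ (-C)) ^ 2 = (M : ℝ) ^ (-(2 * C)) := by
    rw [← Real.rpow_natCast, ← Real.rpow_mul hMpos.le]
    congr 1
    push_cast
    ring
  have hμ2 : (connectiveConstant 2 ^ M) ^ 2 = connectiveConstant 2 ^ (2 * M) := by
    rw [← pow_mul, mul_comm]
  have hrw : (c * (M : ℝ) ^ (-C) * connectiveConstant 2 ^ M) ^ 2 =
      c ^ 2 * (M : ℝ) ^ (-(2 * C)) * connectiveConstant 2 ^ (2 * M) := by
    rw [mul_pow, mul_pow, hMC2, hμ2]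
  have hexp : (M : ℝ) ^ (-(2 * C + 8)) = (M : ℝ) ^ (-(2 * C)) * ((M : ℝ) ^ 8)⁻¹ := by
    rw [Real.rpow_neg hMpos.le, Real.rpow_neg hMpos.le, Real.rpow_add hMpos, mul_inv,
      show (8 : ℝ) = ((8 : ℕ) : ℝ) by norm_num, Real.rpow_natCast]
  rw [hexp]
  rw [hrw] at hsq2
  have hfin := hsq2.trans hsqR
  calc c ^ 2 / 1296 * ((M : ℝ) ^ (-(2 * C)) * ((M : ℝ) ^ 8)⁻¹) * connectiveConstant 2 ^ (2 * M)
      = (c ^ 2 * (M : ℝ) ^ (-(2 * C)) * connectiveConstant 2 ^ (2 * M)) / (1296 * (M : ℝ) ^ 8) := by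
        field_simp
    _ ≤ (1296 * (M : ℝ) ^ 8 * (countAt 2 (2 * M + 1) eDown : ℝ)) / (1296 * (M : ℝ) ^ 8) :=
        div_le_div_of_nonneg_right hfin (by positivity)
    _ = (countAt 2 (2 * M + 1) eDown : ℝ) := by field_simp

/-- **Subsequential polygon abundance on `ℤ²`** (DGHM 2020 §1.2: a power-law lower bound on the
correction to exponential growth for self-avoiding polygons of a given length is "available only
subsequentially for `ℤ²`"): for every `s > 1`, `M^{-(2s+8)} μ^{2M} / 1296 ≤ c_{2M+1}(0,e)` for
infinitely many `M` (rooted, oriented `(2M+2)`-step polygons through the bond `{e,0}`, `e = (0,-1)`).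
[cite: DuminilCopinGangulyHammondManolescu2020, §1.2 and proof of Proposition 3.1] -/
theorem frequently_rpow_mul_pow_le_countAt_eDown {s : ℝ} (hs : 1 < s) :
    ∃ᶠ M : ℕ in atTop, (M : ℝ) ^ (-(2 * s + 8)) / 1296 * connectiveConstant 2 ^ (2 * M) ≤
      (countAt 2 (2 * M + 1) eDown : ℝ) := by
  have h := (frequently_rpow_mul_pow_le_bridgeCount 2 hs).and_eventually (eventually_ge_atTop 1)
  refine h.mono fun M ⟨hb, hM⟩ => ?_
  have hb' : 1 * (M : ℝ) ^ (-s) * connectiveConstant 2 ^ M ≤ (bridgeCount 2 M : ℝ) := by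
    rwa [one_mul]
  have := countAt_eDown_ge_of_bridgeCount_ge hM zero_le_one hb'
  calc (M : ℝ) ^ (-(2 * s + 8)) / 1296 * connectiveConstant 2 ^ (2 * M)
      = 1 ^ 2 / 1296 * (M : ℝ) ^ (-(2 * s + 8)) * connectiveConstant 2 ^ (2 * M) := by ring
    _ ≤ (countAt 2 (2 * M + 1) eDown : ℝ) := this

end Literature.Probability.RandomPlanarGeometry.SAW.Zd
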